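import Summits.BirchSwinnertonDyer.Rank1Residual.GaloisImage.KolyvaginCoreGraphPair
import HarnessLib

/-!
# Base rigidity at `m = 1`: when the EMPTY level is a core vertex, a Kolyvagin system with `κ_1 = 0`
# vanishes — with ONE mixed pair of classes (no residual self-duality, no coisotropy, no core rank)
# (cell `b2b-bsdres`, team n1011, rows T-R1-56-G / R1-58; seat p11; r1 ROUTE-1 §34.3 "BASE RIGIDITY",
# a paper sketch by r1 checked and kernel-proved here)

HONEST FRAMING (verbatim for the cell): research route; prove what is provable now; no claim beyond
stated classes; nothing booked; no mark / label moved.  TOOL theorems, no definition, no named fact.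

Setting of R1-16 (`CoreRankZero.kolyvaginSystems_eq_bot_of_hasCoreRank_zero`): `K` a number field,
`M = T̄` finite killed by the prime `p`, `inv` a Poitou–Tate family, `𝓕` unramified outside `S` with
finite Selmer / dual Selmer groups, a Kolyvagin datum `D` with `𝒫 ∩ S = ∅`, admissible comparison
maps and the local shape `#H¹_ur = #H¹_tr = p`, `H¹ = H¹_ur + H¹_tr` at `𝒫`.  HYPOTHESES ON `𝓕` at the
empty level ONLY: `#H¹_𝓕(K, T̄) = p` and `H¹_{𝓕^*}(K, T̄^D) = 0` (the empty level is a core vertex of a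
core-rank-one structure); PRIME CHOICE: Rubin's Prop. 2.7.1 pair shape (`hpair`: one class of
`H¹(K, T̄)`, one of `H¹(K, T̄^D)`, infinitely many `𝔮 ∈ 𝒫` seeing both; = R1-16 `_of_infinite`).
CONCLUSION (`apply_eq_zero_of_apply_empty_eq_zero`): every `κ ∈ KS₁(T̄, 𝓕, 𝒫)` with `κ_1 = 0`
vanishes identically; hence `κ ↦ κ_1` is injective on `KS₁` and `#KS₁ ≤ p`.

This is the `n₀ = 1` case of `CoreRankOne.apply_eq_zero_of_apply_core_eq_zero`
(`KolyvaginCoreGraphConnected.lean`), which for an ARBITRARY core vertex needs the connectedness of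
`X⁰` (four-class prime choice, residual coisotropy); from the base ONE auxiliary prime suffices
(r1, ROUTE-1 §34.3 (0)–(5); induction on `#c`: a minimal bad `κ_c` generates `H¹_𝓕` and dies on `c`;
with `D_{q₀} = ⟨d⟩` the dual line of `𝓕_{q₀}` and `q′` seeing `κ_c` and `d`, `κ_{c′q′} = 0` below `c`,
`κ_{cq′} ∈ H¹_{𝓕(q′)} ∩ ker loc_{q₀} = 0` by three pair countings, contradicting `loc_{q′} κ_{cq′} ≠ 0`).

References: [Rubin2011] Prop. 2.3.2 (1), 2.6.1, 2.7.1, Cor. 2.8.9 (2) (pp. 19–25); [Sakamoto2024]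
§6, Prop. 7.6 (pp. 930–936); r1 `cells/n1011/ROUTE-1.md` §34.3.
-/

noncomputable section

open scoped Classical NumberField ContRepresentation
open Function NumberField IsDedekindDomain
open Literature.NumberTheory.GaloisRepresentations Literature.NumberTheory.GaloisRepresentations.DiscreteGaloisModule
  Literature.NumberTheory.GaloisCohomology
open Summit.BirchSwinnertonDyer.Rank1Residual.GaloisImage.CoreRankZero
open Summit.BirchSwinnertonDyer.Rank1Residual.X11b.Levels

universe u

namespace Summit.BirchSwinnertonDyer.Rank1Residual.GaloisImage.CoreRankOne

variable {K : Type u} [Field K] [NumberField K]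
variable {M : Type u} [AddCommGroup M] [TopologicalSpace M] [DiscreteTopology M] [Finite M]
variable {ρ : DiscreteGaloisModule K M}

/-! ## §21. Two bookkeeping lemmas -/
omit [Finite M] in
/-- A class of `H(d)` that dies at the primes of `d ∖ e` lies in `H(e)` (`e ⊆ d`): at those primes
any condition contains `0`, elsewhere the conditions agree. [cite: Rubin2011, Def. 2.1.1 (p. 17)] -/
theorem mem_selmerGroup_atLevel_of_subset (D : KolyvaginDatum ρ) (𝓕 : SelmerStructure ρ)
    {d e : Finset (HeightOneSpectrum (𝓞 K))} (hed : e ⊆ d) {x : galoisCohomology ρ 1}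
    (hx : x ∈ (D.atLevel 𝓕 d).selmerGroup)
    (h0 : ∀ q ∈ d, q ∉ e → galoisCohomology.localization ρ (Sum.inr q) 1 x = 0) :
    x ∈ (D.atLevel 𝓕 e).selmerGroup := by
  rw [SelmerStructure.mem_selmerGroup_iff] at hx ⊢
  intro v
  rcases v with w | q
  · exact hx (Sum.inl w)
  · by_cases hqd : q ∈ d
    · by_cases hqe : q ∈ e
      · rw [Level.atLevel_inr_of_mem D 𝓕 hqe]
        have h := hx (Sum.inr q)
        rwa [Level.atLevel_inr_of_mem D 𝓕 hqd] at h
      · rw [h0 q hqd hqe]; exact zero_mem _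
    · have hqe : q ∉ e := fun h => hqd (hed h)
      rw [Level.atLevel_inr_of_not_mem D 𝓕 hqe]
      have h := hx (Sum.inr q)
      rwa [Level.atLevel_inr_of_not_mem D 𝓕 hqd] at h

/-- **A Kolyvagin system dies at a new prime above a vanishing level**: if `κ_d = 0` and `𝔮 ∈ 𝒫 ∖ d`
then `loc_𝔮 κ_{d𝔮} = 0` (its singular part is `φ^{fs}_𝔮(loc_𝔮 κ_d) = 0`, so it lies in
`H¹_ur ∩ H¹_tr = 0`). [cite: Rubin2011, Def. 2.2.1 (p. 18)] -/
theorem localization_apply_insert_eq_zero_of_apply_eq_zero {p : ℕ} {D : KolyvaginDatum ρ}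
    (hadm : D.IsAdmissible)
    (hU : ∀ q ∈ D.primes, Nat.card (unramifiedSubgroup (GaloisRep.toLocal q ρ) 1) = p)
    (hT : ∀ q ∈ D.primes, Nat.card (D.transverse (Sum.inr q)) = p)
    (hUT : ∀ q ∈ D.primes,
      unramifiedSubgroup (GaloisRep.toLocal q ρ) 1 ⊔ D.transverse (Sum.inr q) = ⊤)
    {𝓕 : SelmerStructure ρ} {κ : Finset (HeightOneSpectrum (𝓞 K)) → galoisCohomology ρ 1}
    (hκ : D.IsKolyvaginSystem 𝓕 κ) {d : Finset (HeightOneSpectrum (𝓞 K))} (hd : D.IsLevel d)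
    {q : HeightOneSpectrum (𝓞 K)} (hq : q ∈ D.primes) (hqd : q ∉ d) (h0 : κ d = 0) :
    galoisCohomology.localization ρ (Sum.inr q) 1 (κ (insert q d)) = 0 := by
  have hrel := hκ.fs_rel d hd q hq hqd
  have hL : KolyvaginDatum.singularLocalization ρ q (κ (insert q d)) =
      singularMap (GaloisRep.toLocal q ρ)
        (galoisCohomology.localization ρ (Sum.inr q) 1 (κ (insert q d))) := rfl
  rw [hL, h0, map_zero, singularMap_eq_zero_iff] at hrel
  have hmemT : galoisCohomology.localization ρ (Sum.inr q) 1 (κ (insert q d)) ∈ D.transverse (Sum.inr q) := by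
    have h := (SelmerStructure.mem_selmerGroup_iff _ _).1 (hκ.mem_selmerGroup _ (hd.insert hq)) (Sum.inr q)
    rwa [Level.atLevel_insert_inr_self] at h
  have hmem : (galoisCohomology.localization ρ (Sum.inr q) 1 (κ (insert q d)) :
      galoisCohomology (GaloisRep.toLocal q ρ) 1) ∈
        unramifiedSubgroup (GaloisRep.toLocal q ρ) 1 ⊓ D.transverse (Sum.inr q) :=
    AddSubgroup.mem_inf.2 ⟨hrel, hmemT⟩
  rw [unramified_inf_transverse_eq_bot hadm hU hT hUT hq] at hmem
  exact (AddSubgroup.mem_bot (G := galoisCohomology (GaloisRep.toLocal q ρ) 1)).1 hmem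

/-! ## §22. Base rigidity -/

section Main

variable {p : ℕ} [Fact p.Prime] {inv : LocalInvariants K p}
    (hperf : inv.IsPerfect) (hsum : inv.SumLocalTermEqZero) (hcompl : inv.SelmerComplement)
    (hM : ∀ m : M, p • m = 0) {S : Finset (Place K)}
    (hS : ∀ v : HeightOneSpectrum (𝓞 K), (Sum.inr v : Place K) ∉ S →
      ((p : ℕ) : 𝓞 K) ∉ v.asIdeal ∧ GaloisRep.IsUnramifiedAt v ρ)
    {𝓕 : SelmerStructure ρ} (h𝓕 : 𝓕.IsUnramifiedOutside S)
    (h1 : Nat.card 𝓕.selmerGroup = p) (h0 : (inv.dualSelmerStructure ρ 𝓕).selmerGroup = ⊥)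
    {D : KolyvaginDatum ρ} (hPS : ∀ q ∈ D.primes, (Sum.inr q : Place K) ∉ S)
    (hadm : D.IsAdmissible)
    (hU : ∀ q ∈ D.primes, Nat.card (unramifiedSubgroup (GaloisRep.toLocal q ρ) 1) = p)
    (hT : ∀ q ∈ D.primes, Nat.card (D.transverse (Sum.inr q)) = p)
    (hUT : ∀ q ∈ D.primes,
      unramifiedSubgroup (GaloisRep.toLocal q ρ) 1 ⊔ D.transverse (Sum.inr q) = ⊤)
    (hpair : ∀ x : galoisCohomology ρ 1, x ≠ 0 → ∀ y : galoisCohomology (ρ.tateDual p) 1, y ≠ 0 →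
      {q ∈ D.primes | galoisCohomology.localization ρ (Sum.inr q) 1 x ≠ 0 ∧
        galoisCohomology.localization (ρ.tateDual p) (Sum.inr q) 1 y ≠ 0}.Infinite)

include hperf hsum hcompl hM hS h𝓕 h1 h0 hPS hadm hU hT hUT hpair

/-- **BASE RIGIDITY (r1 ROUTE-1 §34.3; Rubin Prop. 2.3.2 (1) / Cor. 2.8.9 (2) at the empty core
vertex, `m = 1`).**  If `#H¹_𝓕(K, T̄) = p` and `H¹_{𝓕^*}(K, T̄^D) = 0`, and for every non-zero
`x ∈ H¹(K, T̄)`, `y ∈ H¹(K, T̄^D)` infinitely many `𝔮 ∈ 𝒫` have `loc_𝔮 x ≠ 0 ≠ loc_𝔮 y` (ONE mixed pair),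
then every Kolyvagin system `κ` for `(T̄, 𝓕, 𝒫)` with `κ_1 = 0` vanishes at every level.  No residual
self-duality, no coisotropy, no core-rank hypothesis beyond the empty level, no three/four-class
prime choice. [cite: Rubin2011, Prop. 2.3.2 (1) and Cor. 2.8.9 (2) (pp. 19, 25)]
[cite: Sakamoto2024, Prop. 7.6, proof (p. 936)] -/
theorem apply_eq_zero_of_apply_empty_eq_zero
    {κ : Finset (HeightOneSpectrum (𝓞 K)) → galoisCohomology ρ 1} (hκ : D.IsKolyvaginSystem 𝓕 κ)
    (hκ₀ : κ ∅ = 0) (n : Finset (HeightOneSpectrum (𝓞 K))) : κ n = 0 := by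
  have hp : p.Prime := Fact.out; haveI := DiscreteGaloisModule.TateDual.finite K M p
  haveI : Finite 𝓕.selmerGroup := Nat.finite_of_card_ne_zero (by rw [h1]; exact hp.ne_zero)
  haveI : Finite (inv.dualSelmerStructure ρ 𝓕).selmerGroup := by rw [h0]; infer_instance
  -- strong induction on the number of primes in the level
  suffices h : ∀ (k : ℕ) (c : Finset (HeightOneSpectrum (𝓞 K))), c.card = k → κ c = 0 from h _ n rfl
  intro k
  induction k using Nat.strong_induction_on with
  | _ k ih =>
    intro c hck
    by_cases hc : D.IsLevel c
    swap
    · exact hκ.eq_zero_of_not_isLevel c hc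
    rcases c.eq_empty_or_nonempty with rfl | ⟨q₀, hq₀⟩
    · exact hκ₀
    have IH : ∀ c' : Finset (HeightOneSpectrum (𝓞 K)), c'.card < c.card → κ c' = 0 :=
      fun c' hc' => ih _ (hck ▸ hc') c' rfl
    have hprime_of : ∀ {q}, q ∈ c → q ∈ D.primes := fun hq => hc (Finset.mem_coe.2 hq)
    have hlvl : ∀ {e : Finset (HeightOneSpectrum (𝓞 K))}, e ⊆ c → D.IsLevel e := fun he =>
      Set.Subset.trans (Finset.coe_subset.2 he) hc
    by_contra hne
    -- (0) `κ_c` dies at every prime of `c`, hence lies in (and generates) the line `H¹_𝓕`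
    have hloc0 : ∀ q ∈ c, galoisCohomology.localization ρ (Sum.inr q) 1 (κ c) = 0 := by
      intro q hq
      have h := localization_apply_insert_eq_zero_of_apply_eq_zero hadm hU hT hUT hκ
        (d := c.erase q) (hlvl (Finset.erase_subset q c)) (hprime_of hq) (Finset.notMem_erase q c) (IH _ (Finset.card_erase_lt_of_mem hq))
      rwa [Finset.insert_erase hq] at h
    have hκF : κ c ∈ 𝓕.selmerGroup := by
      have h := mem_selmerGroup_atLevel_of_subset D 𝓕 (Finset.empty_subset c) (hκ.mem_selmerGroup c hc)
        (fun q hq _ => hloc0 q hq)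
      rwa [show D.atLevel 𝓕 ∅ = 𝓕 from SelmerStructure.modify_empty 𝓕 D.transverse] at h
    have hline : AddSubgroup.zmultiples (κ c) = 𝓕.selmerGroup := eq_zmultiples_of_natCard_eq_prime hp h1 hκF hne
    have hFloc : ∀ q ∈ c, ∀ x ∈ 𝓕.selmerGroup, galoisCohomology.localization ρ (Sum.inr q) 1 x = 0 := by
      intro q hq x hx
      rw [← hline, AddSubgroup.mem_zmultiples_iff] at hx
      obtain ⟨k, rfl⟩ := hx
      rw [map_zsmul, hloc0 q hq, smul_zero]
    -- the Selmer groups of `𝓕` made strict at primes: `H¹_{𝓕_q} = H¹_𝓕` for `q ∈ c`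
    have hstrict_c : ∀ q ∈ c, (𝓕.strictAt {q}).selmerGroup = 𝓕.selmerGroup := fun q hq => by
      ext x; rw [mem_selmerGroup_strictAt_iff]
      exact ⟨fun h => h.1, fun h => ⟨h, hFloc q hq x h⟩⟩
    have hUq : ∀ {q}, q ∈ D.primes → Nat.card (𝓕 (Sum.inr q)) = p := fun hq => by
      rw [h𝓕.2 _ (hPS _ hq)]; exact hU _ hq
    have h𝓕S : ∀ (T : Finset (HeightOneSpectrum (𝓞 K))),
        𝓕.IsUnramifiedOutside (S ∪ T.map ⟨Sum.inr, Sum.inr_injective⟩) := fun T =>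
      ⟨fun w => Finset.mem_union_left _ (h𝓕.1 w), fun v hv => h𝓕.2 v fun h => hv (Finset.mem_union_left _ h)⟩
    -- (1) the line `D_{q₀} = H¹_{(𝓕_{q₀})^*}`
    have hq₀P := hprime_of hq₀
    have hD₀ : Nat.card (inv.dualSelmerStructure ρ (𝓕.strictAt {q₀})).selmerGroup = p := by
      have P := natCard_mul_natCard_dual_strictAt hperf hsum hcompl hM (places_cond_union hS {q₀}) (h𝓕S {q₀})
        q₀ (inr_mem_union S (Finset.mem_singleton_self q₀))
      rw [hstrict_c q₀ hq₀, h0, AddSubgroup.card_bot, mul_one, h1, hUq hq₀P] at P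
      exact mul_left_cancel₀ hp.ne_zero P
    have hD₀ne : (inv.dualSelmerStructure ρ (𝓕.strictAt {q₀})).selmerGroup ≠ ⊥ := fun h =>
      hp.one_lt.ne' (by rw [← hD₀, h, AddSubgroup.card_bot])
    obtain ⟨d, hd, hd0⟩ := (AddSubgroup.bot_or_exists_ne_zero _).resolve_left hD₀ne
    -- (2) the auxiliary prime `q'`
    obtain ⟨q', ⟨hq', hcq', hdq'⟩, hq'c⟩ := (hpair (κ c) hne d hd0).exists_notMem_finset c
    have hcq'lvl : D.IsLevel (insert q' c) := hc.insert hq'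
    have hatF : ∀ v : Place K, v ≠ Sum.inr q' → D.atLevel 𝓕 {q'} v = 𝓕 v := by
      intro v hv
      rcases v with w | ℓ
      · rfl
      · exact Level.atLevel_inr_of_not_mem D 𝓕 (Finset.notMem_singleton.2 fun h => hv (by rw [h]))
    -- `H¹_𝓕 ∩ ker loc_{q'} = 0`
    have hker : 𝓕.selmerGroup ⊓ (galoisCohomology.localization ρ (Sum.inr q') 1).ker = ⊥ :=
      eq_bot_of_le_of_natCard_eq_prime_of_not_mem hp inf_le_left h1 hκF fun h => hcq' ((AddMonoidHom.mem_ker).1 h.2)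
    -- (3) `κ_{c' q'} = 0` for every proper subset `c' ⊊ c`
    have h3 : ∀ (j : ℕ) (c' : Finset (HeightOneSpectrum (𝓞 K))), c' ⊆ c → c' ≠ c → c'.card = j →
        κ (insert q' c') = 0 := by
      intro j
      induction j using Nat.strong_induction_on with
      | _ j ihj =>
        intro c' hc'c hc'ne hj
        have hc' : D.IsLevel c' := hlvl hc'c
        have hlt : c'.card < c.card := Finset.card_lt_card (Finset.ssubset_iff_subset_ne.2 ⟨hc'c, hc'ne⟩)
        have hq'c' : q' ∉ c' := fun h => hq'c (hc'c h)
        -- it dies at `q'` (κ_{c'} = 0 by the outer induction) and at every `q ∈ c'` (inner induction)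
        have hz_q' : galoisCohomology.localization ρ (Sum.inr q') 1 (κ (insert q' c')) = 0 :=
          localization_apply_insert_eq_zero_of_apply_eq_zero hadm hU hT hUT hκ hc' hq' hq'c' (IH c' hlt)
        have hz_q : ∀ q ∈ c', galoisCohomology.localization ρ (Sum.inr q) 1 (κ (insert q' c')) = 0 := by
          intro q hq
          have hqq' : q ≠ q' := fun h => hq'c' (h ▸ hq)
          have hsub : c'.erase q ⊆ c := (Finset.erase_subset q c').trans hc'c
          have hne' : c'.erase q ≠ c := fun h => lt_irrefl c.card (by
            calc c.card = (c'.erase q).card := by rw [h]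
              _ < c'.card := Finset.card_erase_lt_of_mem hq
              _ < c.card := hlt)
          have hin := ihj _ (hj ▸ Finset.card_erase_lt_of_mem hq) (c'.erase q) hsub hne' rfl
          have h := localization_apply_insert_eq_zero_of_apply_eq_zero hadm hU hT hUT hκ
            (d := insert q' (c'.erase q)) ((hlvl hsub).insert hq') (hprime_of (hc'c hq))
            (fun h => by
              rcases Finset.mem_insert.1 h with h | h
              · exact hqq' h
              · exact Finset.notMem_erase q c' h) hin
          rwa [Finset.insert_comm, Finset.insert_erase hq] at h
        -- so it lies in `H¹_𝓕 ∩ ker loc_{q'} = 0`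
        have hF : κ (insert q' c') ∈ 𝓕.selmerGroup := by
          have h := mem_selmerGroup_atLevel_of_subset D 𝓕 (Finset.empty_subset _)
            (hκ.mem_selmerGroup _ (hc'.insert hq')) (fun q hq _ => by
              rcases Finset.mem_insert.1 hq with rfl | hq
              · exact hz_q'
              · exact hz_q q hq)
          rwa [show D.atLevel 𝓕 ∅ = 𝓕 from SelmerStructure.modify_empty 𝓕 D.transverse] at h
        have hmem : κ (insert q' c') ∈ 𝓕.selmerGroup ⊓ (galoisCohomology.localization ρ (Sum.inr q') 1).ker :=
          ⟨hF, (AddMonoidHom.mem_ker).2 hz_q'⟩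
        rw [hker] at hmem
        exact (AddSubgroup.mem_bot).1 hmem
    -- (4) `y = κ_{c q'}` dies on `c`, so lies in `H¹_{𝓕(q')}` and in `ker loc_{q₀}`
    have hy_c : ∀ q ∈ c, galoisCohomology.localization ρ (Sum.inr q) 1 (κ (insert q' c)) = 0 := by
      intro q hq
      have hqq' : q ≠ q' := fun h => hq'c (h ▸ hq)
      have h := localization_apply_insert_eq_zero_of_apply_eq_zero hadm hU hT hUT hκ
        (d := insert q' (c.erase q)) ((hlvl (Finset.erase_subset q c)).insert hq') (hprime_of hq)
        (fun h => by
          rcases Finset.mem_insert.1 h with h | h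
          · exact hqq' h
          · exact Finset.notMem_erase q c h)
        (h3 _ (c.erase q) (Finset.erase_subset q c) (fun h => Finset.notMem_erase q c (h.symm ▸ hq)) rfl)
      rwa [Finset.insert_comm, Finset.insert_erase hq] at h
    have hy1 : κ (insert q' c) ∈ (D.atLevel 𝓕 {q'}).selmerGroup := by
      refine mem_selmerGroup_atLevel_of_subset D 𝓕 (Finset.singleton_subset_iff.2 (Finset.mem_insert_self q' c))
        (hκ.mem_selmerGroup _ hcq'lvl) fun q hq hq1 => ?_
      rcases Finset.mem_insert.1 hq with rfl | hq
      · exact absurd (Finset.mem_singleton_self _) hq1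
      · exact hy_c q hq
    -- (4)(i) `{q'}` is a core vertex and `#H¹_{𝓕(q')} ≤ p`
    have h1lvl : D.IsLevel ({q'} : Finset _) := by
      intro x hx; rw [Finset.coe_singleton, Set.mem_singleton_iff] at hx; exact hx ▸ hq'
    have hD' : (inv.dualSelmerStructure ρ (𝓕.strictAt {q'})).selmerGroup = ⊥ := by
      have P := natCard_mul_natCard_dual_strictAt hperf hsum hcompl hM (places_cond_union hS {q'}) (h𝓕S {q'})
        q' (inr_mem_union S (Finset.mem_singleton_self q'))
      have hW : (𝓕.strictAt {q'}).selmerGroup = ⊥ := by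
        refine eq_bot_of_le_of_natCard_eq_prime_of_not_mem hp (B := 𝓕.selmerGroup)
          (fun x hx => ((mem_selmerGroup_strictAt_iff _ _ _).1 hx).1) h1 hκF fun h => hcq' ?_
        exact ((mem_selmerGroup_strictAt_iff _ _ _).1 h).2
      rw [hW, h0, AddSubgroup.card_bot, AddSubgroup.card_bot, one_mul, one_mul, h1, hUq hq'] at P
      exact AddSubgroup.card_eq_one.1 (mul_left_cancel₀ hp.ne_zero (P.trans (mul_one p).symm))
    have hcore1 : (inv.dualSelmerStructure ρ (D.atLevel 𝓕 {q'})).selmerGroup = ⊥ := by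
      rw [eq_bot_iff, ← hD']
      exact LocalInvariants.selmerGroup_dualSelmerStructure_anti inv ρ fun v => by
        by_cases hv : v = Sum.inr q'
        · subst hv; rw [Level.strictAt_inr_self]; exact bot_le
        · rw [Level.strictAt_apply_of_ne _ q' hv, hatF v hv]
    haveI := finite_selmerGroup_atLevel D 𝓕 inferInstance ({q'} : Finset (HeightOneSpectrum (𝓞 K)))
    have hH1le : Nat.card (D.atLevel 𝓕 {q'}).selmerGroup ≤ p := by
      have h := natCard_selmerGroup_le_of_loc_injective (𝓛' := D.atLevel 𝓕 {q'}) q' (fun x hx hx0 => by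
        have hx' : x ∈ (D.atLevel 𝓕 ∅).selmerGroup :=
          (mem_selmerGroup_atLevel_insert_iff_of_localization_eq_zero D 𝓕 ∅ q' hx0).1 hx
        rw [show D.atLevel 𝓕 ∅ = 𝓕 from SelmerStructure.modify_empty 𝓕 D.transverse] at hx'
        have hmem : x ∈ 𝓕.selmerGroup ⊓ (galoisCohomology.localization ρ (Sum.inr q') 1).ker :=
          ⟨hx', (AddMonoidHom.mem_ker).2 hx0⟩
        rw [hker] at hmem
        exact (AddSubgroup.mem_bot).1 hmem)
      have hTq : Nat.card (D.atLevel 𝓕 {q'} (Sum.inr q')) = p := by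
        rw [Level.atLevel_inr_of_mem D 𝓕 (Finset.mem_singleton_self q')]; exact hT q' hq'
      rwa [hTq] at h
    -- (4)(ii) `D_{q₀ q'} = D_{q₀}`, and the dual group `E` of `𝓕(q')_{q₀}` vanishes
    have hq₀q' : q₀ ≠ q' := fun h => hq'c (h ▸ hq₀)
    have h𝓑S : (𝓕.strictAt {q₀}).IsUnramifiedOutside (S ∪ ({q₀, q'} : Finset _).map ⟨Sum.inr, Sum.inr_injective⟩) :=
      Level.isUnramifiedOutside_of_apply_eq_of_ne (h𝓕S {q₀, q'}) q₀
        (inr_mem_union S (Finset.mem_insert_self q₀ _)) fun v hv => Level.strictAt_apply_of_ne _ q₀ hv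
    haveI hfinD₀ : Finite (inv.dualSelmerStructure ρ (𝓕.strictAt {q₀})).selmerGroup :=
      Nat.finite_of_card_ne_zero (by rw [hD₀]; exact hp.ne_zero)
    have hD₀₁ : Nat.card (inv.dualSelmerStructure ρ ((𝓕.strictAt {q₀}).strictAt {q'})).selmerGroup = p := by
      have P := natCard_mul_natCard_dual_strictAt hperf hsum hcompl hM (places_cond_union hS {q₀, q'}) h𝓑S q'
        (inr_mem_union S (Finset.mem_insert_of_mem (Finset.mem_singleton_self q')))
      have hW : ((𝓕.strictAt {q₀}).strictAt {q'}).selmerGroup = ⊥ := by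
        refine eq_bot_of_le_of_natCard_eq_prime_of_not_mem hp (B := 𝓕.selmerGroup)
          (fun x hx => ?_) h1 hκF fun h => hcq' ((mem_selmerGroup_strictAt_iff _ _ _).1 h).2
        have h' := ((mem_selmerGroup_strictAt_iff _ _ _).1 hx).1
        rw [hstrict_c q₀ hq₀] at h'
        exact h'
      rw [hW, AddSubgroup.card_bot, one_mul, hstrict_c q₀ hq₀, h1, hD₀,
        Level.strictAt_apply_of_ne _ q₀ (fun h => hq₀q' (Sum.inr_injective h).symm), hUq hq'] at P
      exact mul_left_cancel₀ hp.ne_zero P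
    have hD₀eq : (inv.dualSelmerStructure ρ ((𝓕.strictAt {q₀}).strictAt {q'})).selmerGroup =
        (inv.dualSelmerStructure ρ (𝓕.strictAt {q₀})).selmerGroup := by
      haveI : Finite (inv.dualSelmerStructure ρ ((𝓕.strictAt {q₀}).strictAt {q'})).selmerGroup :=
        Nat.finite_of_card_ne_zero (by rw [hD₀₁]; exact hp.ne_zero)
      exact (AddSubgroup.eq_of_le_of_card_ge (dualSelmerGroup_le_dualSelmerGroup_strictAt inv _ q')
        (by rw [hD₀, hD₀₁])).symm
    have hE : (inv.dualSelmerStructure ρ ((D.atLevel 𝓕 {q'}).strictAt {q₀})).selmerGroup = ⊥ := by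
      have hle : (inv.dualSelmerStructure ρ ((D.atLevel 𝓕 {q'}).strictAt {q₀})).selmerGroup ≤
          (inv.dualSelmerStructure ρ (𝓕.strictAt {q₀})).selmerGroup := by
        rw [← hD₀eq]
        refine LocalInvariants.selmerGroup_dualSelmerStructure_anti inv ρ fun v => ?_
        by_cases hv₀ : v = Sum.inr q₀
        · subst hv₀
          rw [Level.strictAt_apply_of_ne _ q' (fun h => hq₀q' (Sum.inr_injective h)), Level.strictAt_inr_self]
          exact bot_le
        by_cases hv' : v = Sum.inr q'
        · subst hv'; rw [Level.strictAt_inr_self]; exact bot_le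
        rw [Level.strictAt_apply_of_ne _ q' hv', Level.strictAt_apply_of_ne _ q₀ hv₀,
          Level.strictAt_apply_of_ne _ q₀ hv₀, hatF v hv']
      refine eq_bot_of_le_of_natCard_eq_prime_of_not_mem hp hle hD₀ hd fun hdE => hdq' ?_
      have h1' := (SelmerStructure.mem_selmerGroup_iff _ _).1 hd (Sum.inr q')
      rw [LocalInvariants.dualSelmerStructure_apply,
        Level.strictAt_apply_of_ne _ q₀ (fun h => hq₀q' (Sum.inr_injective h).symm), h𝓕.2 q' (hPS q' hq')] at h1'
      have h2' := (SelmerStructure.mem_selmerGroup_iff _ _).1 hdE (Sum.inr q')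
      rw [LocalInvariants.dualSelmerStructure_apply,
        Level.strictAt_apply_of_ne _ q₀ (fun h => hq₀q' (Sum.inr_injective h).symm),
        Level.atLevel_inr_of_mem D 𝓕 (Finset.mem_singleton_self q')] at h2'
      have h12 := AddSubgroup.mem_inf.2 ⟨h1', h2'⟩
      rwa [dual_unramified_inf_dual_transverse_eq_bot hperf hM hUT hq', AddSubgroup.mem_bot] at h12
    -- (4)(iii) `H¹_{𝓕(q')} ∩ ker loc_{q₀} = 0`
    have hW₀ : ((D.atLevel 𝓕 {q'}).strictAt {q₀}).selmerGroup = ⊥ := by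
      have P := natCard_mul_natCard_dual_strictAt hperf hsum hcompl hM (places_cond_union hS {q', q₀})
        (isUnramifiedOutside_atLevel_union h𝓕 D (Finset.singleton_subset_iff.2 (Finset.mem_insert_self q' _))) q₀
        (inr_mem_union S (Finset.mem_insert_of_mem (Finset.mem_singleton_self q₀)))
      have hUq₀ : Nat.card (D.atLevel 𝓕 {q'} (Sum.inr q₀)) = p := by
        rw [hatF _ (fun h => hq₀q' (Sum.inr_injective h))]; exact hUq hq₀P
      rw [hE, hcore1, AddSubgroup.card_bot, mul_one, mul_one, hUq₀] at P
      -- `P : #H¹_{𝓕(q')} = #W₀ · p`, and `#H¹_{𝓕(q')} ≤ p`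
      have hfinW : Finite ((D.atLevel 𝓕 {q'}).strictAt {q₀}).selmerGroup :=
        Finite.of_injective (fun x => (⟨x.1, ((mem_selmerGroup_strictAt_iff _ _ _).1 x.2).1⟩ :
          (D.atLevel 𝓕 {q'}).selmerGroup)) fun x y hxy => by
            have h := congrArg Subtype.val hxy
            exact Subtype.ext h
      have hWle : Nat.card ((D.atLevel 𝓕 {q'}).strictAt {q₀}).selmerGroup ≤ 1 := by
        refine Nat.le_of_mul_le_mul_right ?_ hp.pos
        rw [one_mul, ← P]; exact hH1le
      exact AddSubgroup.card_eq_one.1 (le_antisymm hWle Nat.card_pos)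
    have hy0 : κ (insert q' c) = 0 := by
      have hmem : κ (insert q' c) ∈ ((D.atLevel 𝓕 {q'}).strictAt {q₀}).selmerGroup :=
        (mem_selmerGroup_strictAt_iff _ _ _).2 ⟨hy1, hy_c q₀ hq₀⟩
      rw [hW₀] at hmem
      exact (AddSubgroup.mem_bot).1 hmem
    -- (5) but `loc_{q'} κ_{c q'} ≠ 0` by the finite–singular relation and admissibility
    exact apply_insert_ne_zero_of_localization_ne_zero h𝓕 hPS hadm hκ hc hq' hq'c hcq' (by rw [hy0, map_zero])

/-- **`κ ↦ κ_1` is injective on `KS₁(T̄, 𝓕, 𝒫)` when the empty level is a core vertex** (the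
fact's `Function.Bijective` clause shape at `d = ∅`). [cite: Rubin2011, Cor. 2.8.9 (2) (p. 25)] -/
theorem injective_eval_kolyvaginSystems_empty :
    Function.Injective fun κ : D.kolyvaginSystems 𝓕 =>
      (⟨κ.1 ∅, ((KolyvaginDatum.mem_kolyvaginSystems_iff D 𝓕 κ.1).mp κ.2).mem_selmerGroup ∅ D.isLevel_empty⟩ :
        (D.atLevel 𝓕 ∅).selmerGroup) := by
  intro κ κ' h
  have hd0 : (κ - κ').1 ∅ = 0 := by
    have h' := congrArg Subtype.val h
    change κ.1 ∅ = κ'.1 ∅ at h'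
    change κ.1 ∅ - κ'.1 ∅ = 0
    rw [h', sub_self]
  have hall := apply_eq_zero_of_apply_empty_eq_zero hperf hsum hcompl hM hS h𝓕 h1 h0 hPS hadm hU hT hUT hpair
    ((KolyvaginDatum.mem_kolyvaginSystems_iff D 𝓕 _).mp (κ - κ').2) hd0
  rw [← sub_eq_zero]
  exact Subtype.ext (funext hall)

/-- **`#KS₁(T̄, 𝓕, 𝒫) ≤ p` when the empty level is a core vertex** (base rigidity: `κ ↦ κ_1` is
injective into the group `H¹_𝓕(K, T̄)` of order `p`). [cite: Rubin2011, Cor. 2.8.9 (2) (p. 25)] -/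
theorem natCard_kolyvaginSystems_le_of_empty :
    Nat.card (D.kolyvaginSystems 𝓕) ≤ p := by
  have hp : p.Prime := Fact.out
  haveI : Finite (D.atLevel 𝓕 ∅).selmerGroup := by
    rw [show D.atLevel 𝓕 ∅ = 𝓕 from SelmerStructure.modify_empty 𝓕 D.transverse]
    exact Nat.finite_of_card_ne_zero (by rw [h1]; exact hp.ne_zero)
  have h := Nat.card_le_card_of_injective _ (injective_eval_kolyvaginSystems_empty hperf hsum hcompl hM hS h𝓕
    h1 h0 hPS hadm hU hT hUT hpair)
  rwa [show D.atLevel 𝓕 ∅ = 𝓕 from SelmerStructure.modify_empty 𝓕 D.transverse, h1] at h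

end Main

end Summit.BirchSwinnertonDyer.Rank1Residual.GaloisImage.CoreRankOne

end
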